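import Mathlib
import HarnessLib

/-!
# `NoHeavyLowerTail` (crux stmt-CriticalPhenomena-4575), antipodal-Kleitman programme: ROW PAIRING — matchable polarized preorders are
# universal gluing partners (THEOREM M of the half-gluing / atom-gluing problem)

Support file (seat `prim-ineq-gen-7` gen 49; `--supports stmt-CriticalPhenomena-4575`, closed crux; independent mathematics continuing the
antipodal-Kleitman (AK) line of `…KnQuestion8AntitheticProduct` (`antipodalKleitman_prod`, gen 17) and `…KnQuestion8AntitheticHalfDouble`
(`half_double_ak`, gen 45)).  No `sorry`, no definitions, no named facts; standard axioms.
Memo: `run/shared/lean/prim/prim-ineq-gen-7/FINDING-HG-g49.md` §1–§3.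

DICTIONARY (memo §1).  Let `X` be a finite poset with an order-reversing fixed-point-free involution `ι` and a HALF `L` (a down-set with
`ι L = X ∖ L`).  Odd monotone functions on `X` are the same as monotone functions `u` on the upper half `P = X ∖ L` with `u a + u b ≥ 0`
whenever `ι a ≤ b`; writing `a ~ b :⟺ ι a ≤ b` (a symmetric relation on `P`, up-closed in each argument: a *polarity*) the AK inequality
`#(U ∩ ι V) ≤ #(U ∩ V)` for all up-sets `U, V` of `X` becomes PROPERTY A of the *polarized preorder* `(P, ≤, ~)`:
`∑ c, f c * g c ≥ 0` for all `f, g` in the cone `K(P) = {f monotone | f a + f b ≥ 0 whenever a ~ b}` (hypothesis `hA` below).  An element `s`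
with `s ~ s` is *self-polar*.  The HALF-GLUING `Z = (L × M) ∪ (ιL × ιM) ⊆ X × Y` of two such structures (CONJECTURE HG of gen 48 = the ATOM GLUING
`Ω_{P₁ ∪ₐ P₂}` of colouring posets, the open 'only if' tool of CONJECTURE Cβ) has upper half the product `P₁ × P₂` with the product order and
the product polarity `(i,a) ~ (j,b) :⟺ i ~ j ∧ a ~ b`; HG says: property A of `P₁` and of `P₂` implies property A of `P₁ × P₂`.

THIS FILE.  Call `P₁` MATCHABLE if its non-self-polar elements `p` can be matched injectively to self-polar elements `p⋆` with `p ≤ p⋆` and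
`p ~ p⋆`; below the matching is encoded by an involution `mate` of `P₁` (`mate p = p⋆`, `mate p⋆ = p`, all other points fixed) whose fixed
points are self-polar.
* `AntitheticRowPairing.two_rows` — LEMMA B1: if `x ≤ y` pointwise, `x, y` monotone and `x a + y b ≥ 0` for `a ~ b` (and the same for
  `x', y'`), then `∑ (x x' + y y') ≥ 0` on every `P` with property A.  Proof: `x x' + y y' = ½ (x+y)(x'+y') + ½ (y−x)(y'−x')` with `x + y ∈ K(P)`
  and `y − x ≥ 0`.
* `AntitheticRowPairing.matchable_product` — THEOREM M: for MATCHABLE `P₁` and ANY `P₂` with property A, every `u, v : P₁ × P₂ → ℝ` monotone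
  for the product order with `u (i,a) + u (j,b) ≥ 0` whenever `i ~ j`, `a ~ b` (same for `v`) satisfy `∑ u·v ≥ 0`; i.e. `P₁ × P₂` has property A
  (nothing is assumed about `P₁` beyond matchability — with `P₂` a point this contains property A of `P₁` itself).  Proof: the row `u(s,·)` of a
  self-polar `s` lies in `K(P₂)`; the rows of a matched pair `(p, p⋆)` satisfy the hypotheses of `two_rows`; sum over the involution `mate`.
CONSEQUENCES (memo §2–§3, §7).  (i) Matchable halves glue: `Z` is AK whenever `X`'s upper half is matchable and `Y` is AK — this is the
combinatorial content of 214 of the 218 one-sided gluing certificates found by LP for the polarized preorders with ≤ 4 points (memo §3;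
the 4 failures `C4.44, C4.61, C4.66, H` are unmatchable).  (ii) For colouring posets: the atom half of `Ω_Q` at `a` is matchable iff every
`I`-cone has ≤ 2 colourings (memo §2: every colouring `s` has a UNIQUE polar partner above it); e.g. the 3-chain rooted at its bottom, so
`Ω_{C₃ ∪ₐ Q}` is AK for every poset `Q` with `Ω_Q` AK — in particular the five-poset `Y₅ = C₃ ∪₀ Λ`, one of the two 5-element posets outside
the provable class P⁺ of gen 45 (the other, the W-fence, is the first UNMATCHABLE gluing: memo §4, conjecture TQ).
[cite: KozmaNitzan2024, Questions 8–9 (§5.5 p. 36) (context of the programme)]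
-/

namespace Summit.CriticalPhenomena.PercolationContinuityZ3.Theorems

open Finset

namespace AntitheticRowPairing

section TwoRows

variable {P : Type*} [Fintype P] [Preorder P]

/-- **LEMMA B1 (two rows).**  `P` a finite preorder with a symmetric relation `pol` and PROPERTY A (`hA`: `∑ f g ≥ 0` for monotone `f, g`
with `f a + f b ≥ 0`, `g a + g b ≥ 0` whenever `pol a b`).  If `x ≤ y` pointwise, `x, y` monotone and `x a + y b ≥ 0` whenever `pol a b`
(then automatically `y a + y b ≥ 0`, i.e. `y ∈ K(P)`), and likewise for `x', y'`, then `∑ c, (x c * x' c + y c * y' c) ≥ 0`.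
Proof: `x x' + y y' = ((x+y)(x'+y') + (y−x)(y'−x')) / 2`, `x + y` and `x' + y'` satisfy the hypotheses of `hA` (by symmetry of `pol`), and
`(y−x)(y'−x') ≥ 0` pointwise. [this work] -/
theorem two_rows (pol : P → P → Prop) (hsym : ∀ a b, pol a b → pol b a)
    (hA : ∀ f g : P → ℝ, Monotone f → Monotone g → (∀ a b, pol a b → 0 ≤ f a + f b) →
      (∀ a b, pol a b → 0 ≤ g a + g b) → 0 ≤ ∑ c, f c * g c)
    (x y x' y' : P → ℝ) (hx : Monotone x) (hy : Monotone y) (hx' : Monotone x') (hy' : Monotone y')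
    (hxy : ∀ c, x c ≤ y c) (hxy' : ∀ c, x' c ≤ y' c)
    (hpxy : ∀ a b, pol a b → 0 ≤ x a + y b) (hpxy' : ∀ a b, pol a b → 0 ≤ x' a + y' b) :
    0 ≤ ∑ c, (x c * x' c + y c * y' c) := by
  have h1 : 0 ≤ ∑ c, (x c + y c) * (x' c + y' c) := by
    refine hA (fun c => x c + y c) (fun c => x' c + y' c) (fun a b hab => add_le_add (hx hab) (hy hab))
      (fun a b hab => add_le_add (hx' hab) (hy' hab)) ?_ ?_
    · intro a b hab
      have e1 := hpxy a b hab
      have e2 := hpxy b a (hsym a b hab)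
      linarith
    · intro a b hab
      have e1 := hpxy' a b hab
      have e2 := hpxy' b a (hsym a b hab)
      linarith
  have h2 : 0 ≤ ∑ c, (y c - x c) * (y' c - x' c) :=
    Finset.sum_nonneg (fun c _ => mul_nonneg (sub_nonneg.mpr (hxy c)) (sub_nonneg.mpr (hxy' c)))
  have h3 : ∑ c, (x c * x' c + y c * y' c) =
      (∑ c, ((x c + y c) * (x' c + y' c) + (y c - x c) * (y' c - x' c))) / 2 := by
    rw [Finset.sum_div]
    refine Finset.sum_congr rfl (fun c _ => ?_)
    ring
  rw [h3, Finset.sum_add_distrib]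
  linarith

end TwoRows

section Matchable

variable {P₁ P₂ : Type*} [Fintype P₁] [Fintype P₂] [Preorder P₁] [Preorder P₂]

/-- **THEOREM M (row pairing): matchable polarized preorders are universal gluing partners.**
`P₂` carries a symmetric relation `pol₂` and has property A (`hA₂`).  `P₁` carries a relation `pol₁` and an involution `mate` whose fixed points
are self-polar (`pol₁ i i`) and whose 2-cycles `{i, mate i}` are *matched pairs*: one of the two points lies below the other and is
`pol₁`-related to it (`hup`; the upper point is then automatically self-polar by up-closure, but this is not even needed).  Then for all `u, v : P₁ × P₂ → ℝ`, monotone for the product order and *cross-admissible*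
(`u (i,a) + u (j,b) ≥ 0` whenever `pol₁ i j` and `pol₂ a b`, same for `v`): `0 ≤ ∑ z, u z * v z`.  In the dictionary of the module docstring: the
half-gluing of an AK poset whose upper half is matchable with ANY AK poset is AK (THEOREM M of memo FINDING-HG-g49 §3). [this work] -/
theorem matchable_product (pol₁ : P₁ → P₁ → Prop) (pol₂ : P₂ → P₂ → Prop) (hsym₂ : ∀ a b, pol₂ a b → pol₂ b a)
    (hA₂ : ∀ f g : P₂ → ℝ, Monotone f → Monotone g → (∀ a b, pol₂ a b → 0 ≤ f a + f b) →
      (∀ a b, pol₂ a b → 0 ≤ g a + g b) → 0 ≤ ∑ c, f c * g c)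
    (mate : P₁ → P₁) (hmate : Function.Involutive mate) (hfix : ∀ i, mate i = i → pol₁ i i)
    (hup : ∀ i, mate i ≠ i → (i ≤ mate i ∧ pol₁ i (mate i)) ∨ (mate i ≤ i ∧ pol₁ (mate i) i))
    (u v : P₁ × P₂ → ℝ) (hu : Monotone u) (hv : Monotone v)
    (hpu : ∀ i j a b, pol₁ i j → pol₂ a b → 0 ≤ u (i, a) + u (j, b))
    (hpv : ∀ i j a b, pol₁ i j → pol₂ a b → 0 ≤ v (i, a) + v (j, b)) :
    0 ≤ ∑ z, u z * v z := by
  -- monotone sections (rows)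
  have urow : ∀ i, Monotone (fun a => u (i, a)) := fun i a b h => hu (Prod.mk_le_mk.2 ⟨le_rfl, h⟩)
  have vrow : ∀ i, Monotone (fun a => v (i, a)) := fun i a b h => hv (Prod.mk_le_mk.2 ⟨le_rfl, h⟩)
  -- row sums
  set r : P₁ → ℝ := fun i => ∑ a, u (i, a) * v (i, a) with hr
  have hsum : ∑ z, u z * v z = ∑ i, r i := by
    rw [Fintype.sum_prod_type]
  -- a pair of rows (i below j, i ~ j) is nonnegative
  have pair : ∀ i j, i ≤ j → pol₁ i j → 0 ≤ r i + r j := by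
    intro i j hij hpij
    have h := two_rows pol₂ hsym₂ hA₂ (fun a => u (i, a)) (fun a => u (j, a)) (fun a => v (i, a)) (fun a => v (j, a))
      (urow i) (urow j) (vrow i) (vrow j)
      (fun c => hu (Prod.mk_le_mk.2 ⟨hij, le_rfl⟩)) (fun c => hv (Prod.mk_le_mk.2 ⟨hij, le_rfl⟩))
      (fun a b hab => hpu i j a b hpij hab) (fun a b hab => hpv i j a b hpij hab)
    have e : ∑ c, (u (i, c) * v (i, c) + u (j, c) * v (j, c)) = r i + r j := by
      rw [Finset.sum_add_distrib]
    linarith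
  -- each orbit {i, mate i} of the involution contributes a nonnegative amount
  have orbit : ∀ i, 0 ≤ r i + r (mate i) := by
    intro i
    by_cases h : mate i = i
    · have hrow : 0 ≤ r i :=
        hA₂ (fun a => u (i, a)) (fun a => v (i, a)) (urow i) (vrow i)
          (fun a b hab => hpu i i a b (hfix i h) hab) (fun a b hab => hpv i i a b (hfix i h) hab)
      rw [h]
      linarith
    · rcases hup i h with ⟨hle, hpol⟩ | ⟨hle, hpol⟩
      · exact pair i (mate i) hle hpol
      · have := pair (mate i) i hle hpol
        linarith
  have hperm : ∑ i, r (mate i) = ∑ i, r i :=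
    Fintype.sum_equiv (Function.Involutive.toPerm mate hmate) _ _ (fun _ => rfl)
  have htot : 0 ≤ ∑ i, (r i + r (mate i)) := Finset.sum_nonneg (fun i _ => orbit i)
  rw [Finset.sum_add_distrib, hperm] at htot
  rw [hsum]
  linarith

/-- **COROLLARY (totally self-polar factor).**  If every point of `P₁` is self-polar (`pol₁ i i` for all `i`) — e.g. the upper half of the twisted
double of gen 45's half-doubling lemma, or the atom half of `Ω_Q` when `Q` has a unique minimal element covered by leaves only — then `P₁ × P₂` has
property A for every `P₂` with property A (take `mate = id`). [this work] -/
theorem selfpolar_product (pol₁ : P₁ → P₁ → Prop) (pol₂ : P₂ → P₂ → Prop) (hsym₂ : ∀ a b, pol₂ a b → pol₂ b a)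
    (hA₂ : ∀ f g : P₂ → ℝ, Monotone f → Monotone g → (∀ a b, pol₂ a b → 0 ≤ f a + f b) →
      (∀ a b, pol₂ a b → 0 ≤ g a + g b) → 0 ≤ ∑ c, f c * g c)
    (hself : ∀ i : P₁, pol₁ i i)
    (u v : P₁ × P₂ → ℝ) (hu : Monotone u) (hv : Monotone v)
    (hpu : ∀ i j a b, pol₁ i j → pol₂ a b → 0 ≤ u (i, a) + u (j, b))
    (hpv : ∀ i j a b, pol₁ i j → pol₂ a b → 0 ≤ v (i, a) + v (j, b)) :
    0 ≤ ∑ z, u z * v z :=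
  matchable_product pol₁ pol₂ hsym₂ hA₂ id (fun _ => rfl) (fun i _ => hself i) (fun _ h => (h rfl).elim) u v hu hv hpu hpv

end Matchable

end AntitheticRowPairing

end Summit.CriticalPhenomena.PercolationContinuityZ3.Theorems
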